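import Summits.AtomisticToContinuum.HydrodynamicLimit.Theorems.InfluenceLocality.Negative.TubeEnclosure
import HarnessLib

/-!
# `InfluenceLocality` (stmt-AtomisticToContinuum-13916) — no contact between separated tubes (stub `stub_tubeNoContact`)

Line `ignition-cascade-refutation` (lead c3), Phase 2 (construction of `IgnitionTemplates`). The phase sets of the
eventual phase script (Negative/PhaseScript.lean, `PhaseScript.TrackValid`) are FREE-FLIGHT TUBES on the flat torus
`T3`: states `(t, y, w)` with `‖w - v‖ ≤ δv` whose back-extrapolation `y + proj ((t₀ - t) • w)` to the nominal time
`t₀` lies within `δx` (minimal-image distance `Torus.euclidDist`) of the nominal point `x`. By the tube enclosure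
(`stub_tubeEnclosure`, Negative/TubeEnclosure.lean) such a state lies within `δx + |t - t₀| * δv` of the nominal free
flight `x + proj ((t - t₀) • v)`. This file discharges the `sep` field of `PhaseScript.TrackValid` for pairs of
SPATIALLY SEPARATED tubes: if at a common time `t` the two nominal free-flight points are farther apart (minimal-image
distance) than `ε` plus the two enclosure radii, two states of the tubes are not at contact distance `ε`.
Design-independent; asserts no Theses decl.
-/

namespace Summit.AtomisticToContinuum.HydrodynamicLimit.Theorems.InfluenceLocality.Negative

open MeasureTheory Set
open scoped InnerProductSpace
open Literature.Analysis.FluidPDE Literature.MathematicalPhysics.KineticTheory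
open Literature.Analysis.FunctionSpaces

noncomputable section

/-- NO CONTACT BETWEEN SEPARATED TUBES. Two tube states `(t, y₁, w₁)`, `(t, y₂, w₂)` at a common time `t` (tube `i`
with nominal data `(tᵢ, xᵢ, vᵢ)` and tolerances `(δxᵢ, δvᵢ)`: `‖wᵢ - vᵢ‖ ≤ δvᵢ` and the back-extrapolated position
`yᵢ + proj ((tᵢ - t) • wᵢ)` is within `δxᵢ` of `xᵢ`) whose nominal points `xᵢ + proj ((t - tᵢ) • vᵢ)` are more than
`ε + (δx₁ + |t - t₁| * δv₁) + (δx₂ + |t - t₂| * δv₂)` apart (minimal-image distance) are not in contact: their torus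
separation vector does not have norm `ε`. Proof: `‖sepVec y₁ y₂‖ = euclidDist y₁ y₂` (`Torus.norm_geometry_sepVec`);
each `yᵢ` is within `δxᵢ + |t - tᵢ| * δvᵢ` of its nominal point (`stub_tubeEnclosure`); two triangle inequalities
for `euclidDist` then give `euclidDist y₁ y₂ > ε`. -/
theorem stub_tubeNoContact (ε t₁ t₂ t : ℝ) (x₁ x₂ y₁ y₂ : T3) (v₁ v₂ w₁ w₂ : V3) (δx₁ δv₁ δx₂ δv₂ : ℝ)
    (hw₁ : ‖w₁ - v₁‖ ≤ δv₁) (hy₁ : Torus.euclidDist (y₁ + Torus.proj ((t₁ - t) • w₁)) x₁ ≤ δx₁)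
    (hw₂ : ‖w₂ - v₂‖ ≤ δv₂) (hy₂ : Torus.euclidDist (y₂ + Torus.proj ((t₂ - t) • w₂)) x₂ ≤ δx₂)
    (hfar : ε + (δx₁ + |t - t₁| * δv₁) + (δx₂ + |t - t₂| * δv₂) <
      Torus.euclidDist (x₁ + Torus.proj ((t - t₁) • v₁)) (x₂ + Torus.proj ((t - t₂) • v₂))) :
    ‖(Torus.geometry (Fin 3)).sepVec y₁ y₂‖ ≠ ε := by
  -- triangle inequality of the minimal-image distance
  -- (adapted from `Torus.euclidDist_triangle`, Literature/Analysis/FluidPDE/ConfinedHardSphereFlowShortBad.lean,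
  --  which is not in the import closure of this file; three lines from `Torus.euclidDist_translate_le`)
  have tri : ∀ a b c : T3, Torus.euclidDist a c ≤ Torus.euclidDist a b + Torus.euclidDist b c := by
    intro a b c
    have h := Torus.euclidDist_translate_le a b (0 : V3) (Torus.reprSym (c - b))
    rwa [Torus.proj_zero, add_zero, Torus.proj_reprSym, add_sub_cancel, zero_sub, norm_neg,
      ← Torus.euclidDist_eq, Torus.euclidDist_comm c b] at h
  -- tube enclosures: `yᵢ` is within `δxᵢ + |t - tᵢ| * δvᵢ` of the nominal point `xᵢ + proj ((t - tᵢ) • vᵢ)`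
  have h₁ := stub_tubeEnclosure t₁ t x₁ y₁ v₁ w₁ δx₁ δv₁ hw₁ hy₁
  have h₂ := stub_tubeEnclosure t₂ t x₂ y₂ v₂ w₂ δx₂ δv₂ hw₂ hy₂
  rw [Torus.euclidDist_comm] at h₁
  -- chain the nominal points through `y₁` and `y₂`
  have h₃ := tri (x₁ + Torus.proj ((t - t₁) • v₁)) y₁ (x₂ + Torus.proj ((t - t₂) • v₂))
  have h₄ := tri y₁ y₂ (x₂ + Torus.proj ((t - t₂) • v₂))
  rw [Torus.norm_geometry_sepVec]
  intro h
  linarith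

end

end Summit.AtomisticToContinuum.HydrodynamicLimit.Theorems.InfluenceLocality.Negative
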